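import Summits.AtomisticToContinuum.Crystallization.Theorems.ChargedEnergyGapChartDialJ

/-!
# `ChargedEnergyGap` · the CHART DIAL, part K: the DICTIONARY SPLIT — shape and gap (decomp-a2c lens-3 g39 node «ChargeFreeGap»)

Beneath the dictionary hypothesis `ChargeFreeCharted θ` (part A §2), hypothesis 3 of the line of record beneath
`ChartedChargePricing θ` (part J, `chartedChargePricing_of_far_cleanApproachHarnack`:
`FarFieldPricing θ R → CleanApproachHarnack θ R M₀ M₁ → ChargeFreeCharted θ → ChartedChargePricing θ`).

`ChartedAt θ Q p` reads the METRIC shell of `p` (every point of `Q` within `6/5·nn(p)`), while charge is read on the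
BOND dozen of `p` (its `(1/100)`-bond neighbours, all within `101/100·nn(p)`).  The dictionary «charge-free ⟹ charted»
therefore has two conjuncts of different nature, and this file splits it EXACTLY:

§1 THE SPLIT (proved, every `θ`): `ChargeFreeCharted θ ↔ ChargeFreeShaped θ ∧ ChargeFreeGapped`
   (`chargeFreeCharted_iff_shaped_and_gapped`); pointwise, at a charge-free `p`,
   `ChartedAt θ Q p ↔ BondChartedAt θ Q p ∧ GappedAt Q p` (`chartedAt_iff_bondChartedAt_and_gappedAt`):
   * SHAPE `BondChartedAt θ Q p` — the bond dozen of `p`, recentred and rescaled by `nn(p)` (the shell frame of part E),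
     is `θ`-close (`ShellCloseTo`) to the FCC or the HCP kissing pattern: a statement about TWELVE LABELLED POINTS
     (finite-dimensional; instrumentable — census ask I-CHART(b));
   * GAP `GappedAt Q p` — every point of `Q` in the punctured `6/5·nn(p)`-ball of `p` is a bond neighbour of `p`
     (the annulus `(101/100, 6/5]·nn(p)` of a charge-free site is empty).
   Both conjuncts are WEAKER than `ChartedAt θ Q p` (the converse directions `gappedAt_of_chartedAt` — the count
   «twelve bond neighbours ⊆ twelve shell points» — and `bondChartedAt_of_chartedAt` are proved).
§2 THE GAP LEMMA (proved, energy-free): `θ ≤ 1/8 → BondChartedAt θ Q p → GappedAt Q p`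
   (`gappedAt_of_bondChartedAt`; NO charge hypothesis): a thirteenth point `q` with `nn(p) ≤ |q − p| ≤ 6/5·nn(p)` lies
   within `45°` of a direction of the chart's pattern (part F cap lemma `exists_mem_pattern_inner_ge`), hence at frame
   distance `< 173/200 + θ ≤ 99/100` from the matched bond neighbour `q'` (`dist_lt_of_cap`:
   `61/25 − (6/5)·√2 < (173/200)²`), i.e. `dist q q' < (99/100)·nn(p) ≤ (9999/10000)·nn(q') < nn(q')` — so `q = q'`.
   Hence `ChargeFreeCharted θ ↔ ChargeFreeShaped θ` for `θ ≤ 1/8` (`chargeFreeCharted_iff_shaped`) and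
   `ChargeFreeShaped θ → ChargeFreeCharted θ'` for `θ ≤ 1/8`, `θ ≤ θ'` (`chargeFreeCharted_of_shaped`): up to `θ = 1/8`
   the dictionary IS the pure twelve-point shape statement.  At the dial of record `θ = 3/20` the single-vertex bound
   fails (`45° + arcsin (3/20) ≈ 53.6° > 52.5°`); closing the gap there needs the four-rings of charge-freeness
   (part L, the «square lemma»).
§3 THE LINE RE-ASSEMBLED (proved): `FarFieldPricing θ' R → CleanApproachHarnack θ' R M₀ M₁ → ChargeFreeShaped θ →
   ChartedChargePricing θ'` for `θ ≤ 1/8`, `θ ≤ θ' ≤ 3/20` (`chartedChargePricing_of_far_cleanApproachHarnack_shaped`).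

No `sorry`, no new axiom, no instance / notation / option.  New `Prop`s: `BondChartedAt`, `GappedAt`,
`ChargeFreeShaped`, `ChargeFreeGapped`; new set `bondShellSet`; graph abbreviation `bonds`.
-/

noncomputable section

open Literature.MathematicalPhysics.StatisticalMechanics
open Literature.Geometry.DiscreteGeometry
open Summit.AtomisticToContinuum.Crystallization.Theses.PricedLinkCensus
open Summit.AtomisticToContinuum.Crystallization.Theorems.ChargedEnergyGapNegative
open RealInnerProductSpace
namespace Summit.AtomisticToContinuum.Crystallization.Theorems.ChargedEnergyGapChartDial

/-! ## §1 The split of the dictionary: shape and gap -/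

section frame

variable (Q : PeriodicConfiguration 3)

/-- The `(1/100)`-bond graph on the points of `Q` — the graph in which charge (`IsChargeFree (1/100)`) is read. -/
abbrev bonds : SimpleGraph Q.points := bondGraph (1 / 100) (Subtype.val : Q.points → E3)

/-- The BOND SHELL of `p`: its bond neighbours in the shell frame of `p` (recentred at `p`, rescaled by `nn(p)⁻¹`,
`shellCoord` of part E). -/
def bondShellSet (p : Q.points) : Set E3 :=
  (fun q : Q.points => shellCoord Q p q) '' (bonds Q).neighborSet p

/-- Membership in the bond shell. -/
theorem mem_bondShellSet_iff {p : Q.points} {t : E3} :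
    t ∈ bondShellSet Q p ↔ ∃ q : Q.points, (bonds Q).Adj p q ∧ shellCoord Q p q = t :=
  Iff.rfl

/-- Membership in the metric shell `shellSet` (part A), read through the points of `Q`. -/
theorem mem_shellSet_iff {p : Q.points} {t : E3} :
    t ∈ shellSet Q p ↔ ∃ q : Q.points, q ≠ p ∧ dist (p : E3) q ≤ 6 / 5 * nn Q p ∧ shellCoord Q p q = t := by
  constructor
  · rintro ⟨q, ⟨hqQ, hqp, hqd⟩, rfl⟩
    exact ⟨⟨q, hqQ⟩, fun h => hqp (congrArg Subtype.val h), hqd, rfl⟩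
  · rintro ⟨q, hqp, hqd, rfl⟩
    exact shellCoord_mem Q hqp hqd

/-- A bond neighbour of `p` is another point of the `6/5·nn(p)`-ball of `p` (indeed `dist ≤ (101/100)·nn(p)`). -/
theorem mem_shellBall_of_adj {p q : Q.points} (h : (bonds Q).Adj p q) :
    q ≠ p ∧ dist (p : E3) q ≤ 6 / 5 * nn Q p := by
  obtain ⟨hne, -⟩ := bondGraph_adj.1 h
  have hd : dist (p : E3) q ≤ (1 + 1 / 100) * nn Q p := dist_le_of_adj (by norm_num) h
  have hc : 0 ≤ nn Q p := nearestDist_nonneg _ _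
  exact ⟨fun h' => hne h'.symm, by linarith⟩

/-- The bond shell is part of the metric shell. -/
theorem bondShellSet_subset_shellSet (p : Q.points) : bondShellSet Q p ⊆ shellSet Q p := by
  rintro t ⟨q, hq, rfl⟩
  obtain ⟨hqp, hqd⟩ := mem_shellBall_of_adj Q hq
  exact shellCoord_mem Q hqp hqd

/-- **GAP** `GappedAt Q p`: every point of `Q` in the punctured `6/5·nn(p)`-ball of `p` is a bond neighbour of `p`
(no point of `Q` in the annulus `(101/100, 6/5]·nn(p)` around `p`). -/
def GappedAt (p : Q.points) : Prop :=
  ∀ q : Q.points, q ≠ p → dist (p : E3) q ≤ 6 / 5 * nn Q p → (bonds Q).Adj p q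

/-- Under the gap, the metric shell IS the bond shell. -/
theorem shellSet_eq_bondShellSet_of_gappedAt {p : Q.points} (hG : GappedAt Q p) :
    shellSet Q p = bondShellSet Q p := by
  refine Set.Subset.antisymm (fun t ht => ?_) (bondShellSet_subset_shellSet Q p)
  obtain ⟨q, hqp, hqd, rfl⟩ := (mem_shellSet_iff Q).1 ht
  exact ⟨q, hG q hqp hqd, rfl⟩

end frame

/-- **SHAPE** `BondChartedAt θ Q p`: the bond shell of `p` is a finite set `θ`-close (`ShellCloseTo`) to the FCC or
to the HCP kissing pattern — `ChartedAt` (part A) with the metric shell replaced by the bond dozen. -/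
def BondChartedAt (θ : ℝ) (Q : PeriodicConfiguration 3) (p : Q.points) : Prop :=
  ∃ T : Finset E3, (↑T : Set E3) = bondShellSet Q p ∧
    (ShellCloseTo θ T fccKissingPattern ∨ ShellCloseTo θ T hcpKissingPattern)

/-- **`ChargeFreeShaped θ`** — the SHAPE conjunct of the dictionary: the bond dozen of every `(1/100)`-charge-free
point of a periodic configuration is `θ`-close to a kissing pattern (twelve labelled points; census ask I-CHART(b)). -/
def ChargeFreeShaped (θ : ℝ) : Prop :=
  ∀ (Q : PeriodicConfiguration 3) (p : Q.points),
    IsChargeFree (1 / 100) (Subtype.val : Q.points → E3) p → BondChartedAt θ Q p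

/-- **`ChargeFreeGapped`** — the GAP conjunct of the dictionary: the `6/5`-shell ball of every `(1/100)`-charge-free
point of a periodic configuration contains only its bond neighbours. -/
def ChargeFreeGapped : Prop :=
  ∀ (Q : PeriodicConfiguration 3) (p : Q.points),
    IsChargeFree (1 / 100) (Subtype.val : Q.points → E3) p → GappedAt Q p

section split

variable (Q : PeriodicConfiguration 3)

/-- SHAPE and GAP give the chart. -/
theorem chartedAt_of_bondChartedAt {θ : ℝ} {p : Q.points} (hB : BondChartedAt θ Q p) (hG : GappedAt Q p) :
    ChartedAt θ Q p := by
  obtain ⟨T, hT, hclose⟩ := hB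
  exact ⟨T, hT.trans (shellSet_eq_bondShellSet_of_gappedAt Q hG).symm, hclose⟩

/-- **The chart gives the GAP** at a charge-free point: the twelve bond neighbours lie in the shell ball, whose
punctured point set is in bijection (shell frame) with the twelve-point chart — so they exhaust it. -/
theorem gappedAt_of_chartedAt {θ : ℝ} {p : Q.points} (hcf : IsChargeFree (1 / 100) (Subtype.val : Q.points → E3) p)
    (h : ChartedAt θ Q p) : GappedAt Q p := by
  obtain ⟨T, hT, hclose⟩ := h
  set S : Set Q.points := {q | q ≠ p ∧ dist (p : E3) q ≤ 6 / 5 * nn Q p} with hS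
  have himg : (fun q : Q.points => shellCoord Q p q) '' S = shellSet Q p := by
    ext t
    rw [mem_shellSet_iff]
    constructor
    · rintro ⟨q, ⟨hqp, hqd⟩, rfl⟩
      exact ⟨q, hqp, hqd, rfl⟩
    · rintro ⟨q, hqp, hqd, rfl⟩
      exact ⟨q, ⟨hqp, hqd⟩, rfl⟩
  have hinj : Function.Injective (fun q : Q.points => shellCoord Q p q) :=
    fun q r hqr => Subtype.ext (shellCoord_injective Q p hqr)
  have hS12 : S.ncard = 12 := by
    rw [← Set.ncard_image_of_injective S hinj, himg, ← hT, Set.ncard_coe_finset,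
      card_eq_twelve_of_shellCloseTo hclose]
  have hSfin : S.Finite := Set.finite_of_ncard_ne_zero (by rw [hS12]; norm_num)
  have hsub : (bonds Q).neighborSet p ⊆ S := fun q hq => mem_shellBall_of_adj Q hq
  have heq : (bonds Q).neighborSet p = S :=
    Set.eq_of_subset_of_ncard_le hsub (by rw [hS12]; exact le_of_eq hcf.ncard_neighborSet.symm) hSfin
  intro q hqp hqd
  have hq : q ∈ S := ⟨hqp, hqd⟩
  rw [← heq] at hq
  exact hq

/-- The chart gives the SHAPE at a charge-free point. -/
theorem bondChartedAt_of_chartedAt {θ : ℝ} {p : Q.points}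
    (hcf : IsChargeFree (1 / 100) (Subtype.val : Q.points → E3) p) (h : ChartedAt θ Q p) : BondChartedAt θ Q p := by
  obtain ⟨T, hT, hclose⟩ := id h
  exact ⟨T, hT.trans (shellSet_eq_bondShellSet_of_gappedAt Q (gappedAt_of_chartedAt Q hcf h)), hclose⟩

/-- **THE SPLIT, pointwise**: at a charge-free point, charted ⟺ shaped ∧ gapped. -/
theorem chartedAt_iff_bondChartedAt_and_gappedAt {θ : ℝ} {p : Q.points}
    (hcf : IsChargeFree (1 / 100) (Subtype.val : Q.points → E3) p) :
    ChartedAt θ Q p ↔ BondChartedAt θ Q p ∧ GappedAt Q p :=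
  ⟨fun h => ⟨bondChartedAt_of_chartedAt Q hcf h, gappedAt_of_chartedAt Q hcf h⟩,
    fun h => chartedAt_of_bondChartedAt Q h.1 h.2⟩

/-- SHAPE is monotone in the tolerance. -/
theorem bondChartedAt_mono {θ θ' : ℝ} (h : θ ≤ θ') {p : Q.points} (hB : BondChartedAt θ Q p) :
    BondChartedAt θ' Q p := by
  obtain ⟨T, hT, hclose⟩ := hB
  refine ⟨T, hT, ?_⟩
  rcases hclose with ⟨A, hA⟩ | ⟨A, hA⟩
  · exact Or.inl ⟨A, hA.mono h⟩
  · exact Or.inr ⟨A, hA.mono h⟩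

end split

/-- **THE SPLIT OF THE DICTIONARY** (exact, every `θ`): `ChargeFreeCharted θ ↔ ChargeFreeShaped θ ∧ ChargeFreeGapped`. -/
theorem chargeFreeCharted_iff_shaped_and_gapped (θ : ℝ) :
    ChargeFreeCharted θ ↔ ChargeFreeShaped θ ∧ ChargeFreeGapped :=
  ⟨fun h => ⟨fun Q p hp => bondChartedAt_of_chartedAt Q hp (h Q p hp), fun Q p hp => gappedAt_of_chartedAt Q hp (h Q p hp)⟩,
    fun h Q p hp => chartedAt_of_bondChartedAt Q (h.1 Q p hp) (h.2 Q p hp)⟩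

/-- `ChargeFreeShaped` is monotone in `θ`. -/
theorem chargeFreeShaped_mono {θ θ' : ℝ} (h : θ ≤ θ') (hS : ChargeFreeShaped θ) : ChargeFreeShaped θ' :=
  fun Q p hp => bondChartedAt_mono Q h (hS Q p hp)

/-- `ChargeFreeCharted` is monotone in `θ` (part B `chartedAt_mono`). -/
theorem chargeFreeCharted_mono {θ θ' : ℝ} (h : θ ≤ θ') (hD : ChargeFreeCharted θ) : ChargeFreeCharted θ' :=
  fun Q p hp => chartedAt_mono h (hD Q p hp)

/-! ## §2 The gap lemma: up to `θ = 1/8` the shape forces the gap -/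

section gap

/-- In a shell `θ`-close to the FCC or the HCP pattern, every direction `d` has a shell point `t` within `θ` of a
unit vector `w` of the (rotated) pattern with `‖d‖ ≤ √2·⟪d, w⟫` (the `45°` covering of part F, transported by the
chart's isometry as in part G). -/
theorem exists_near_cap_of_shellCloseTo {θ : ℝ} {T : Finset E3}
    (h : ShellCloseTo θ T fccKissingPattern ∨ ShellCloseTo θ T hcpKissingPattern) (d : E3) :
    ∃ t ∈ T, ∃ w : E3, ‖w‖ = 1 ∧ ‖d‖ ≤ Real.sqrt 2 * ⟪d, w⟫ ∧ dist t w ≤ θ := by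
  obtain ⟨P, hP, A, e, he⟩ : ∃ P : Finset E3, (P = fccKissingPattern ∨ P = hcpKissingPattern) ∧
      ∃ (A : E3 →ₗᵢ[ℝ] E3) (e : ↥T ≃ ↥(P.image A)), ∀ t : ↥T, dist (t : E3) (e t : E3) ≤ θ := by
    rcases h with ⟨A, e, he⟩ | ⟨A, e, he⟩
    · exact ⟨_, Or.inl rfl, A, e, he⟩
    · exact ⟨_, Or.inr rfl, A, e, he⟩
  have hP1 : ∀ v ∈ P, ‖v‖ = 1 := by
    rcases hP with rfl | rfl
    · exact fun v hv => norm_eq_one_of_mem_fccKissingPattern hv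
    · exact fun v hv => norm_eq_one_of_mem_hcpKissingPattern hv
  let Ae : E3 ≃ₗᵢ[ℝ] E3 := A.toLinearIsometryEquiv rfl
  have hAe : ∀ v, Ae v = A v := fun v => rfl
  obtain ⟨w, hw, hwd⟩ := exists_mem_pattern_inner_ge hP (Ae.symm d)
  have hwd' : ‖d‖ ≤ Real.sqrt 2 * ⟪d, A w⟫ := by
    have h1 : ⟪Ae.symm d, w⟫ = ⟪d, A w⟫ := by
      rw [← hAe, ← Ae.inner_map_map (Ae.symm d) w, LinearIsometryEquiv.apply_symm_apply]
    rwa [LinearIsometryEquiv.norm_map, h1] at hwd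
  have hw1 : ‖A w‖ = 1 := by rw [A.norm_map, hP1 w hw]
  have hAw : A w ∈ P.image A := Finset.mem_image_of_mem _ hw
  set t : ↥T := e.symm ⟨A w, hAw⟩ with htdef
  have het : (e t : E3) = A w := by rw [htdef, Equiv.apply_symm_apply]
  exact ⟨t, t.2, A w, hw1, hwd', by rw [← het]; exact he t⟩

/-- **The covering estimate**: a point `d` of the frame annulus `1 ≤ ‖d‖ ≤ 6/5` within `45°` of a unit vector `w`
(`‖d‖ ≤ √2·⟪d, w⟫`) is at distance `< 173/200` from it (`‖d − w‖² ≤ 61/25 − (6/5)·√2 = 0.7429… < 0.748225`). -/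
theorem dist_lt_of_cap {d w : E3} (hw : ‖w‖ = 1) (hwd : ‖d‖ ≤ Real.sqrt 2 * ⟪d, w⟫) (h1 : 1 ≤ ‖d‖)
    (h2 : ‖d‖ ≤ 6 / 5) : dist d w < 173 / 200 := by
  have hs2 : Real.sqrt 2 ^ 2 = 2 := Real.sq_sqrt (by norm_num)
  have hs0 : 0 ≤ Real.sqrt 2 := Real.sqrt_nonneg 2
  have hs1 : (14142 : ℝ) / 10000 ≤ Real.sqrt 2 := by nlinarith
  have hsq : dist d w ^ 2 = ‖d‖ ^ 2 - 2 * ⟪d, w⟫ + 1 := by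
    rw [dist_eq_norm, norm_sub_sq_real, hw, one_pow]
  have hin : Real.sqrt 2 * ‖d‖ ≤ 2 * ⟪d, w⟫ := by
    calc Real.sqrt 2 * ‖d‖ ≤ Real.sqrt 2 * (Real.sqrt 2 * ⟪d, w⟫) := mul_le_mul_of_nonneg_left hwd hs0
      _ = 2 * ⟪d, w⟫ := by rw [← mul_assoc, ← sq, hs2]
  have hlt : dist d w ^ 2 < (173 / 200) ^ 2 := by
    rw [hsq]
    nlinarith [mul_nonneg (sub_nonneg.2 h1) (sub_nonneg.2 h2), mul_nonneg (sub_nonneg.2 hs1) (sub_nonneg.2 h1)]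
  exact lt_of_pow_lt_pow_left₀ 2 (by norm_num) hlt

variable (Q : PeriodicConfiguration 3)

/-- **THE GAP LEMMA** (energy-free, no charge hypothesis): for `θ ≤ 1/8`, if the bond shell of `p` is `θ`-close
to a kissing pattern then the punctured `6/5·nn(p)`-ball of `p` contains only bond neighbours of `p`.  A point `q`
there has frame position `d`, `1 ≤ ‖d‖ ≤ 6/5`, within `45°` of a pattern direction `w`, whose matched bond neighbour
`q'` sits at frame distance `< 173/200 + θ ≤ 99/100` from `d`: `dist q q' < (99/100)·nn(p) ≤ (9999/10000)·nn(q')`,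
impossible for `q ≠ q'`. -/
theorem gappedAt_of_bondChartedAt {θ : ℝ} (hθ : θ ≤ 1 / 8) {p : Q.points} (hB : BondChartedAt θ Q p) :
    GappedAt Q p := by
  obtain ⟨T, hT, hclose⟩ := hB
  intro q hqp hqd
  have hc : 0 < nn Q p := Blocks.nearestDist_pt_pos Q p
  -- the frame position of `q` lies in the annulus `[1, 6/5]`
  set d : E3 := shellCoord Q p q with hd
  have hdn : dist (p : E3) q = nn Q p * ‖d‖ := dist_eq_nn_mul_norm_shellCoord Q p q
  have hd1 : 1 ≤ ‖d‖ := by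
    have h := nearestDist_le_dist (Subtype.val : Q.points → E3) hqp
    rw [hdn] at h
    exact le_of_mul_le_mul_left (by rw [mul_one]; exact h) hc
  have hd2 : ‖d‖ ≤ 6 / 5 := by
    rw [hdn] at hqd
    exact le_of_mul_le_mul_left (by linarith) hc
  -- a shell point near the cap direction of `d`
  obtain ⟨t, htT, w, hw1, hwd, htw⟩ := exists_near_cap_of_shellCloseTo hclose d
  have hdt : dist d t < 99 / 100 := by
    have h1 := dist_lt_of_cap hw1 hwd hd1 hd2
    have tri := dist_triangle d w t
    rw [dist_comm w t] at tri
    linarith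
  -- `t` is the frame position of a bond neighbour `q'`, and `q` is too close to `q'` to be another point
  have htmem : t ∈ bondShellSet Q p := by rw [← hT]; exact htT
  obtain ⟨q', hq'adj, hq't⟩ := htmem
  have hq't : shellCoord Q p q' = t := hq't
  have hqq' : dist (q : E3) q' < 99 / 100 * nn Q p := by
    rw [dist_eq_nn_mul_dist_shellCoord Q p, ← hd, hq't]
    calc nn Q p * dist d t < nn Q p * (99 / 100) := mul_lt_mul_of_pos_left hdt hc
      _ = 99 / 100 * nn Q p := mul_comm _ _
  by_cases hqq : q = q'
  · subst hqq; exact hq'adj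
  · exfalso
    have hcq' : 0 < nn Q q' := Blocks.nearestDist_pt_pos Q q'
    have h1 : nn Q q' ≤ dist (q' : E3) q := nearestDist_le_dist (Subtype.val : Q.points → E3) hqq
    have h2 : nn Q p ≤ (1 + 1 / 100) * nn Q q' := nearestDist_le_mul_of_adj (by norm_num) hq'adj
    rw [dist_comm] at h1
    linarith

/-- For `θ ≤ 1/8`, SHAPE alone gives the chart. -/
theorem chartedAt_of_bondChartedAt_of_le {θ : ℝ} (hθ : θ ≤ 1 / 8) {p : Q.points} (hB : BondChartedAt θ Q p) :
    ChartedAt θ Q p :=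
  chartedAt_of_bondChartedAt Q hB (gappedAt_of_bondChartedAt Q hθ hB)

end gap

/-- For `θ ≤ 1/8` the SHAPE conjunct implies the GAP conjunct. -/
theorem chargeFreeGapped_of_shaped {θ : ℝ} (hθ : θ ≤ 1 / 8) (hS : ChargeFreeShaped θ) : ChargeFreeGapped :=
  fun Q p hp => gappedAt_of_bondChartedAt Q hθ (hS Q p hp)

/-- **THE DICTIONARY IS THE SHAPE STATEMENT up to `θ = 1/8`**: `ChargeFreeCharted θ ↔ ChargeFreeShaped θ`. -/
theorem chargeFreeCharted_iff_shaped {θ : ℝ} (hθ : θ ≤ 1 / 8) : ChargeFreeCharted θ ↔ ChargeFreeShaped θ := by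
  rw [chargeFreeCharted_iff_shaped_and_gapped]
  exact ⟨fun h => h.1, fun h => ⟨h, chargeFreeGapped_of_shaped hθ h⟩⟩

/-- SHAPE at a tolerance `θ ≤ 1/8` gives the dictionary at every `θ' ≥ θ` — in particular
`ChargeFreeShaped (1/8) → ChargeFreeCharted (3/20)` (the dial of record). -/
theorem chargeFreeCharted_of_shaped {θ θ' : ℝ} (hθ : θ ≤ 1 / 8) (hθ' : θ ≤ θ') (hS : ChargeFreeShaped θ) :
    ChargeFreeCharted θ' :=
  chargeFreeCharted_mono hθ' ((chargeFreeCharted_iff_shaped hθ).2 hS)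

/-! ## §3 The line beneath `ChartedChargePricing` re-assembled on the shape statement -/

/-- **The line beneath P after part K**: `FAR θ' R ∧ NOZOOM-APPROACH θ' R M₀ M₁ ∧ SHAPE θ ⟹ ChartedChargePricing θ'`
for `θ ≤ 1/8`, `θ ≤ θ' ≤ 3/20` (part J composed with `chargeFreeCharted_of_shaped`). -/
theorem chartedChargePricing_of_far_cleanApproachHarnack_shaped {θ θ' R M₀ M₁ : ℝ} (hθ : θ ≤ 1 / 8)
    (hθθ' : θ ≤ θ') (hθ' : θ' ≤ 3 / 20) (hR : 0 < R) (hM₀ : 0 ≤ M₀) (hF : FarFieldPricing θ' R)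
    (hH : CleanApproachHarnack θ' R M₀ M₁) (hS : ChargeFreeShaped θ) : ChartedChargePricing θ' :=
  chartedChargePricing_of_far_cleanApproachHarnack hθ' hR hM₀ hF hH (chargeFreeCharted_of_shaped hθ hθθ' hS)

end Summit.AtomisticToContinuum.Crystallization.Theorems.ChargedEnergyGapChartDial

end
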